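/- Copyright: the b2b-balaban cell (near-miss cell 7), T⁴-continuum fan-out; row NE7b OWNER lineage `t4-ne7b-p1`
(gen 57) — «(ρ) FROM THREE SENTENCES»: the reading's fibre decoration `IndexDecor` built from the data-free forms of
(ρ0) (g55), (ρ1) (g56) and (ρ2) (this gen).  Released under the licence of the surrounding project. -/
import Summits.QuantumFields.BalabanUV.T4Continuum.Support.HistoryRealiseCellsRunSupplyFibreKeysWTVS
import Summits.QuantumFields.BalabanUV.T4Continuum.Support.HistoryGenealogyLiveIndex
import Summits.QuantumFields.BalabanUV.T4Continuum.Support.HistoryBankingFibreEnvelope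

/-!
# «(ρ) FROM THREE SENTENCES»: the fibre decoration of a reading — hence the (α) record's display (ρ) `FibreMass` —
BUILT from «no healing before the cutoff» (ρ0), THE HISTORY COUNT (ρ1) and THE SUM OF SLICE SUPREMA (ρ2), with (ρ3)'s
letters; no decoration, envelope or dead-index DATA

Summits-side support leaf of the T⁴-continuum cell (rung (B)+1 on a FINITE torus only; NOT infinite volume, NOT the
mass gap, NOT the Clay statement; NOT a proof of the spine estimate NE7b — the cell's OWN estimate, NOT PRINTED, NOT
PROVED).  [folklore] composition BY NAME of three owner leaves and one crew constructor: g55's `HistoryGenealogyLiveIndex`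
(`RunInputM.NoHealing`, `HistReading.died_empty_iff_noHealing`), g56's `HistoryBankingFibreCount` (`pairsOf`,
`decorationOfCount`, `decorationOfCount_mem`, `decorationOfCount_inj`), this gen's `HistoryBankingFibreEnvelope` (`supOf`,
`supSum`, `cwOf`, `le_supOf`, `supOf_nonneg`, `fibreMass_of_supSum_count_MULTOf`) and leaf-02's
`HistoryRealiseCellsRunSupplyFibreKeysWTVS.indexDecor_of_keySide` over the custodian's `IndexDecor` ∕
`fibreMass_of_indexDecor` ∕ `hρ_of_indexDecor` ∕ `dmassOf_eq_of_died_empty` (`HistoryRealiseCellsRunSupplyFibreWTVS`); one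
`instance` (a genealogy type is inhabited), two `def`s, no `structure`, no `[cite:]` tag, no `def … : Prop` fact of
Bałaban's, zero `sorry`.  B16 = [Balaban1989LargeFieldII] (1.71)∕(1.72) pp. 378–379, p. 383 l. 25–26, (1.90)∕(1.97)–(1.100)
pp. 388–390 are LOCATORS of the three hypothesis shapes only; nothing printed is asserted.

WHY.  R-OWNER-49-1 decomposed the located display (ρ) `FibreMass` of the (α) record of record (`HistReadDataL(W).hρ`,
then `HistReadDataLWD.decor : IndexDecor …`, then `HistReadDataLWK`'s twelve key-side items) as (ρ0) ∧ (ρ1) ∧ (ρ2) ∧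
(ρ3).  Three owner gens typed the DATA-FREE form of each display that carries data: (ρ0) = the input-level sentence
`NoHealing K` on every read term (g55, `died_empty_iff_noHealing`); (ρ1) = THE HISTORY COUNT
`#pairsOf K k a c ≤ ∏_{w ∈ k} #decG (C K w) w.2.1` (g56, `exists_decoration_iff_count`); (ρ2) = THE SUPSUM
`supSum K k (cwOf Φf t) ≤ W K` (g57, `exists_kdV_iff_supSum`).  This file puts them together: from the three sentences
(plus the (α) record's own per-term input rows `hN`∕`hRm`∕`hD` and `0 < L`, which (ρ0)'s equivalence uses, and (ρ3)'s
letters `C`∕`N` with `hCN`∕`hN`, unchanged) it BUILDS the reading's `IndexDecor` — decoration `:= decorationOfCount`,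
slice envelope `:= supOf … (cwOf Φf t)`, `died_empty` from `NoHealing` — and hence the display (ρ) itself.  So the
R∕T-content of the whole (ρ)-block of the (α) record is EXACTLY three data-free sentences: one about OUR readiness rule
((ρ0), the (d1)–(d5) residue of record), one count per `(K, k, a, c)` ((ρ1), p. 383's sentence per member — PARAMETRIC ∕
reading, referee INFO-74-1), one real inequality per `(K, t, k)` ((ρ2), (1.97) summed under (1.98) — PARAMETRIC by
value); the data `kdDec`∕`kdV`∕`decor` the records display are eliminable, and a record twin carrying the sentences as
fields («LWN») would embed into `HistReadDataLWK` by this file's constructor (DESIGNED here by the binder list of §1; NOT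
commissioned — a record change touching every terminal twin, custodian ON ASK under FREEZE (0)).

WHAT.  §0 `instInhabitedGen` (a bare birth inhabits `Gen ε`).  §1 section data: the reading `ℛ`, factors `Φf`,
thresholds, envelope `W`, shares, carriers `cellOf`∕`phys`∕`jstar`, (ρ3)'s letters `C`∕`N`; hypotheses = the per-term
input rows, **`hNH`** (ρ0), **`hcount`** (ρ1), **`hsup`** (ρ2), `hCN`∕`hN` (ρ3).  §2 **`keysOf`** (the displayed keys:
the bad classes past the threshold), `mem_keysOf`, `hcount_keysOf`; **`decOf`** `:= decorationOfCount … keysOf …`;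
**`indexDecor_of_sentences : IndexDecor ℛ Φf l₀ K₀ W φB φR cellOf phys jstar (Gen (PEv × β)) (SIdx I)`** `:=
indexDecor_of_keySide …` at `dec := decOf`, `v := supOf … (cwOf Φf t)`, `died_empty := (died_empty_iff_noHealing …).2 hNH`.
(+ a non-exported check that `fibreMass_of_indexDecor ∘ indexDecor_of_sentences` has the display's type).  §3
**`fibreMass_of_sentences`** — the display (ρ) of the records for every bad key class (the conclusion of
`fibreMass_of_indexDecor` ∕ `fibreMass_of_keySide` VERBATIM, hypotheses = the sentences as explicit binders) proved
DIRECTLY, WITHOUT BUILDING ANY DECORATION OR ENVELOPE and without `Inhabited β`: (ρ0) makes `dmassOf = cwOf` on read terms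
(`dmassOf_eq_of_died_empty`), then `fibreMass_of_supSum_count_MULTOf` with the COUNT and the SUPSUM.  §4
**`hρ_of_sentences`**: the record-facing instance at the (α) carriers `cellA`∕`physA`∕`jhalf` — the type of
`HistReadDataL(W).hρ` VERBATIM, from the three sentences.

HONEST SCOPE.  By-name composition over OUR carriers; nothing of Bałaban's asserted, instantiated or discharged — the
three sentences ARE the R∕T-content of (ρ) ((ρ0) R modulo the readiness-rule reading; (ρ1) R ∕ PARAMETRIC, the
identification «history pairs of a key fibre = admissible sub-sequences on its members»; (ρ2) T∕PARAMETRIC by value,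
`W K ≤ W∞` T-extensive; (ρ3) K modulo FIBRE-1, served).  BY-NAME EFFECT ON THE WALL: row `resum`∕(ρ) reads «R∕T-record =
three data-free sentences + K (ρ3)»; R∕T-rows by count UNCHANGED (`HistRead`, M1's `Holds`, `FactorRead` by value,
(ρ0)∕(ρ1)∕(ρ2) as sentences, `hΛL`).  NE7b NOT PRINTED ∕ NOT PROVED; spine 0∕9.  HONEST DEPENDENCY (cell): continuum YM
on T⁴ ⇐ BetaPertH ∧ nine spine estimates (0/9 proved); BetaPertH ⇐ (D1) ∧ (D4) ∧ CAP+tail; G-an2-4 gates asym, D1 and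
NE2/3/4.  This file changes none of it.
-/

open Finset
open Literature.MathematicalPhysics.QuantumFieldTheory.Balaban1983to89
open Literature.MathematicalPhysics.QuantumFieldTheory.Balaban1983to89.B13ScaleTransfer
open Literature.MathematicalPhysics.QuantumFieldTheory.Balaban1983to89.T4Continuum
open T4PersistenceDictionary T4LiveClassFibration T4RenewalChains
open Summit.QuantumFields.BalabanUV.T4Continuum.HistoryFlow (two_le_L)
open Summit.QuantumFields.BalabanUV.T4Continuum.HistoryGenealogyRealise
open Summit.QuantumFields.BalabanUV.T4Continuum.HistoryAssemblyPedigree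
open Summit.QuantumFields.BalabanUV.T4Continuum.HistoryAssemblyMult
open Summit.QuantumFields.BalabanUV.T4Continuum.HistoryAssemblyMultKey
open Summit.QuantumFields.BalabanUV.T4Continuum.HistoryPriceNodeSum
open Summit.QuantumFields.BalabanUV.T4Continuum.HistoryPriceKeys
open Summit.QuantumFields.BalabanUV.T4Continuum.HistoryBankingDiscountCharge
open Summit.QuantumFields.BalabanUV.T4Continuum.HistoryBankingFibreResum
open Summit.QuantumFields.BalabanUV.T4Continuum.HistoryBankingFibreDecorKeys
open Summit.QuantumFields.BalabanUV.T4Continuum.HistoryBankingFibreDecorSlice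
open Summit.QuantumFields.BalabanUV.T4Continuum.HistoryBankingFibreCount
open Summit.QuantumFields.BalabanUV.T4Continuum.HistoryBankingFibreEnvelope
open Summit.QuantumFields.BalabanUV.T4Continuum.B16HistoryIndexedRepr
open Summit.QuantumFields.BalabanUV.T4Continuum.HistoryRealiseCellsRunSupplyWTVS
open Summit.QuantumFields.BalabanUV.T4Continuum.HistoryRealiseCellsRunAssemblyWTVSData
open Summit.QuantumFields.BalabanUV.T4Continuum.HistoryRealiseCellsRunSupplyFibreWTVS
open Summit.QuantumFields.BalabanUV.T4Continuum.HistoryRealiseCellsRunSupplyFibreKeysWTVS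

namespace Summit.QuantumFields.BalabanUV.T4Continuum.HistoryBankingFibreSentences

noncomputable section

/-! ## §0 A genealogy type is inhabited (g56's `decorationOfCount` wants `Inhabited` decoration values) -/

/-- a bare birth at step `0` of the default event inhabits the genealogies [folklore] -/
instance instInhabitedGen {ε : Type*} [Inhabited ε] : Inhabited (Gen ε) := ⟨Gen.born default 0⟩

variable {DomK : ℕ → Type*} {I : (K : ℕ) → HIndex (DomK K)} {d : ℕ} {γ δ' : Type*} [DecidableEq γ] [DecidableEq δ']
  {β : Type} [DecidableEq β] [Inhabited β]

/-! ## §1 The reading, the letters, the per-term input rows and THE THREE SENTENCES (section data) -/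

section Sentences

variable (ℛ : HistReading I d) (Φf : HistFactors I d) (l₀ : ℝ) (K₀ : ℕ) (W : ℕ → ℝ)
  (φB : ℕ → ℕ → ℕ → ℝ) (φR : ℕ → ℕ → ℝ) (cellOf : ℕ → HIndex.Idx I → ℕ × Lab d → γ)
  (phys : ℕ → HIndex.Idx I → ℕ × Lab d → δ') (jstar : ℕ → ℕ)
  -- (ρ3)'s letters: per-member per-event choice words and member-free count letters (unchanged, R-OWNER-49-2)
  (C : ℕ → γ × Gen PEv × δ' → PEv → Finset β) (N : ℕ → PEv → ℕ)
  -- the (α) record's own per-term input rows (`HistReadDataLWK.hN`∕`hRm`∕`hD`) and `0 < L` (its `hL` + `hL4`)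
  (hIN : ∀ K, K₀ ≤ K → ∀ τ ∈ HIndex.termSet I K, (ℛ.inputOf.run K τ).NewOK)
  (hIRm : ∀ K, K₀ ≤ K → ∀ τ ∈ HIndex.termSet I K, ∀ t k, (ℛ.inputOf.run K τ).Rm t k ≤ (ℛ.inputOf.run K τ).R t)
  (hID : ∀ K, K₀ ≤ K → ∀ τ ∈ HIndex.termSet I K, (ℛ.inputOf.run K τ).NewDisjoint)
  (hL : 0 < ℛ.L)
  -- (ρ0) THE SENTENCE «NO HEALING BEFORE THE CUTOFF» on every read term [B16 pp. 378–379 (1.71)∕(1.72) + (1.98); g55]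
  (hNH : ∀ K, K₀ ≤ K → ∀ τ ∈ HIndex.termSet I K, (ℛ.inputOf.run K τ).NoHealing K)
  -- (ρ1) THE SENTENCE «THE HISTORY COUNT» per key fibre and summand pair [p. 383 l. 25–26 per member; g56]
  (hcount : ∀ K, K₀ ≤ K →
    ∀ k ∈ badGMems (memOf ℛ.inputOf.pedV ℛ.inputOf.liveCV cellOf) jstar (HIndex.termSet I)
        (kmemOf ℛ.inputOf.pedV ℛ.inputOf.liveCV cellOf phys) K,
      ∀ (a : (I K).Adm) (c : (I K).HC),
        (pairsOf (kmemOf ℛ.inputOf.pedV ℛ.inputOf.liveCV cellOf phys) K k a c).card ≤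
          ∏ w ∈ k, (decG (C K w) w.2.1).card)
  -- (ρ2) THE SENTENCE «THE SUM OF SLICE SUPREMA» per cutoff, source and key [pp. 388–390 (1.90)∕(1.97)–(1.100); g57]
  (hsup : ∀ K t, |t| ≤ l₀ → K₀ ≤ K →
    ∀ k ∈ badGMems (memOf ℛ.inputOf.pedV ℛ.inputOf.liveCV cellOf) jstar (HIndex.termSet I)
        (kmemOf ℛ.inputOf.pedV ℛ.inputOf.liveCV cellOf phys) K,
      supSum (kmemOf ℛ.inputOf.pedV ℛ.inputOf.liveCV cellOf phys) K k (cwOf Φf t) ≤ W K)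
  -- (ρ3) member-free count letters over the member's events [p. 383], and the share check (FIBRE-1)
  (hCN : ∀ K, K₀ ≤ K →
    ∀ k ∈ badGMems (memOf ℛ.inputOf.pedV ℛ.inputOf.liveCV cellOf) jstar (HIndex.termSet I)
        (kmemOf ℛ.inputOf.pedV ℛ.inputOf.liveCV cellOf phys) K,
      ∀ w ∈ k, ∀ e ∈ w.2.1.events, (C K w e).card ≤ N K e)
  (hN : ∀ K e, ((N K e : ℕ) : ℝ) ≤ Real.exp (sharpT (φB K) (φR K) e))

/-! ## §2 The constructor: `IndexDecor` from the three sentences -/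

open Classical in
/-- **THE DISPLAYED KEYS**: the bad key classes of the cutoffs past the threshold (g56's `S K` for `decorationOfCount`).
[folklore] -/
def keysOf (K : ℕ) : Finset (Finset (γ × Gen PEv × δ')) :=
  if K₀ ≤ K then
    badGMems (memOf ℛ.inputOf.pedV ℛ.inputOf.liveCV cellOf) jstar (HIndex.termSet I)
      (kmemOf ℛ.inputOf.pedV ℛ.inputOf.liveCV cellOf phys) K
  else ∅

/-- past the threshold the displayed keys ARE the bad classes [folklore] -/
theorem keysOf_of_le {K : ℕ} (hK : K₀ ≤ K) :
    keysOf ℛ K₀ cellOf phys jstar K =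
      badGMems (memOf ℛ.inputOf.pedV ℛ.inputOf.liveCV cellOf) jstar (HIndex.termSet I)
        (kmemOf ℛ.inputOf.pedV ℛ.inputOf.liveCV cellOf phys) K := by
  unfold keysOf
  rw [if_pos hK]

/-- a displayed key is a bad class of a cutoff past the threshold [folklore] -/
theorem mem_keysOf {K : ℕ} {k : Finset (γ × Gen PEv × δ')} (hk : k ∈ keysOf ℛ K₀ cellOf phys jstar K) :
    K₀ ≤ K ∧ k ∈ badGMems (memOf ℛ.inputOf.pedV ℛ.inputOf.liveCV cellOf) jstar (HIndex.termSet I)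
      (kmemOf ℛ.inputOf.pedV ℛ.inputOf.liveCV cellOf phys) K := by
  unfold keysOf at hk
  by_cases hK : K₀ ≤ K
  · rw [if_pos hK] at hk
    exact ⟨hK, hk⟩
  · rw [if_neg hK] at hk
    exact absurd hk (Finset.notMem_empty _)

omit [Inhabited β] in
include hcount in
/-- the COUNT on the displayed keys, in g56's `hcount` shape [folklore] -/
theorem hcount_keysOf :
    ∀ K, ∀ k ∈ keysOf ℛ K₀ cellOf phys jstar K, ∀ (a : (I K).Adm) (c : (I K).HC),
      (pairsOf (kmemOf ℛ.inputOf.pedV ℛ.inputOf.liveCV cellOf phys) K k a c).card ≤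
        ∏ w ∈ k, ((fun K w => decG (C K w) w.2.1) K w).card :=
  fun K _ hk a c => hcount K (mem_keysOf ℛ K₀ cellOf phys jstar hk).1 _ (mem_keysOf ℛ K₀ cellOf phys jstar hk).2 a c

/-- **THE DECORATION OF THE READING, BUILT FROM THE COUNT** (g56's `decorationOfCount` at the decoration sets
`decG (C K w) w.2.1` on the displayed keys). [folklore] -/
def decOf : ℕ → HIndex.Idx I → γ × Gen PEv × δ' → Gen (PEv × β) :=
  decorationOfCount (kmemOf ℛ.inputOf.pedV ℛ.inputOf.liveCV cellOf phys) (fun K w => decG (C K w) w.2.1)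
    (keysOf ℛ K₀ cellOf phys jstar) (hcount_keysOf ℛ K₀ cellOf phys jstar C hcount)

/-- **THE READING's `IndexDecor` BUILT FROM THE THREE SENTENCES** (leaf-02's `indexDecor_of_keySide` at
`dec := decOf` (from the COUNT), `v K t k := supOf … (cwOf Φf t)` (the slice suprema, from nothing — the SUPSUM is its
`hW`), `died_empty := (died_empty_iff_noHealing …).2 hNH` (from NO HEALING); (ρ3)'s letters pass through). [folklore] -/
def indexDecor_of_sentences : IndexDecor ℛ Φf l₀ K₀ W φB φR cellOf phys jstar (Gen (PEv × β)) (SIdx I) :=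
  indexDecor_of_keySide ℛ Φf l₀ K₀ W φB φR cellOf phys jstar C N (decOf ℛ K₀ cellOf phys jstar C hcount)
    (fun K t k s => supOf (kmemOf ℛ.inputOf.pedV ℛ.inputOf.liveCV cellOf phys) K k (cwOf Φf t) s)
    ((ℛ.died_empty_iff_noHealing hIN hIRm hID hL).2 hNH)
    (fun K hK k hk => decorationOfCount_mem _ _ _ _ K K (by rw [keysOf_of_le ℛ K₀ cellOf phys jstar hK]; exact hk))
    (fun K hK k hk => decorationOfCount_inj _ _ _ _ K K (by rw [keysOf_of_le ℛ K₀ cellOf phys jstar hK]; exact hk))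
    (fun _ _ _ _ _ => supOf_nonneg)
    (fun K t _ _ k _ a h l c hτ => by
      have hle := le_supOf (cw := cwOf Φf t) hτ
      rwa [sliceOf_mk, cwOf_mk] at hle)
    hsup hCN hN

/-- consistency check (not exported): the custodian's junction `fibreMass_of_indexDecor` on the constructor has the type
of the display (ρ) of the records for every bad key class — the same statement §3 proves WITHOUT building anything -/
example :
    ∀ K t, |t| ≤ l₀ → K₀ ≤ K →
      ∀ k ∈ badGMems (memOf ℛ.inputOf.pedV ℛ.inputOf.liveCV cellOf) jstar (HIndex.termSet I)
          (kmemOf ℛ.inputOf.pedV ℛ.inputOf.liveCV cellOf phys) K,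
        ∑ τ ∈ fibre (kmemOf ℛ.inputOf.pedV ℛ.inputOf.liveCV cellOf phys) (HIndex.termSet I) K k,
          dmassOf ℛ Φf t τ ≤ W K * MULTOf (sharpT (φB K) (φR K)) k :=
  fibreMass_of_indexDecor
    (indexDecor_of_sentences ℛ Φf l₀ K₀ W φB φR cellOf phys jstar C N hIN hIRm hID hL hNH hcount hsup hCN hN)

end Sentences

/-! ## §3 The display (ρ) of the records from the three sentences, DIRECTLY (no decoration, no envelope, no `Inhabited`) -/

section Junction

omit [Inhabited β]

variable (ℛ : HistReading I d) (Φf : HistFactors I d) (l₀ : ℝ) (K₀ : ℕ) (W : ℕ → ℝ)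
  (φB : ℕ → ℕ → ℕ → ℝ) (φR : ℕ → ℕ → ℝ) (cellOf : ℕ → HIndex.Idx I → ℕ × Lab d → γ)
  (phys : ℕ → HIndex.Idx I → ℕ × Lab d → δ') (jstar : ℕ → ℕ)
  (C : ℕ → γ × Gen PEv × δ' → PEv → Finset β) (N : ℕ → PEv → ℕ)

/-- **(ρ) `FibreMass` OF THE READING FROM THE THREE SENTENCES, WITHOUT ANY DECORATION OR ENVELOPE** — the display (ρ)
of the records for every bad key class (the conclusion of the custodian's `fibreMass_of_indexDecor` ∕ leaf-02's
`fibreMass_of_keySide`, VERBATIM), from the per-term input rows, NO HEALING (ρ0), THE COUNT (ρ1), THE SUPSUM (ρ2) and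
(ρ3)'s letters: under (ρ0) a read term's mass IS its curly weight (`dmassOf_eq_of_died_empty`), and this gen's
`fibreMass_of_supSum_count_MULTOf` takes the COUNT and the SUPSUM as they stand, (ρ3)'s letters bounding the
decoration-set sizes.  The junction needs no data and no inhabitedness of `β`. [folklore] -/
theorem fibreMass_of_sentences
    (hIN : ∀ K, K₀ ≤ K → ∀ τ ∈ HIndex.termSet I K, (ℛ.inputOf.run K τ).NewOK)
    (hIRm : ∀ K, K₀ ≤ K → ∀ τ ∈ HIndex.termSet I K, ∀ t k, (ℛ.inputOf.run K τ).Rm t k ≤ (ℛ.inputOf.run K τ).R t)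
    (hID : ∀ K, K₀ ≤ K → ∀ τ ∈ HIndex.termSet I K, (ℛ.inputOf.run K τ).NewDisjoint) (hL : 0 < ℛ.L)
    (hNH : ∀ K, K₀ ≤ K → ∀ τ ∈ HIndex.termSet I K, (ℛ.inputOf.run K τ).NoHealing K)
    (hcount : ∀ K, K₀ ≤ K →
      ∀ k ∈ badGMems (memOf ℛ.inputOf.pedV ℛ.inputOf.liveCV cellOf) jstar (HIndex.termSet I)
          (kmemOf ℛ.inputOf.pedV ℛ.inputOf.liveCV cellOf phys) K,
        ∀ (a : (I K).Adm) (c : (I K).HC),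
          (pairsOf (kmemOf ℛ.inputOf.pedV ℛ.inputOf.liveCV cellOf phys) K k a c).card ≤
            ∏ w ∈ k, (decG (C K w) w.2.1).card)
    (hsup : ∀ K t, |t| ≤ l₀ → K₀ ≤ K →
      ∀ k ∈ badGMems (memOf ℛ.inputOf.pedV ℛ.inputOf.liveCV cellOf) jstar (HIndex.termSet I)
          (kmemOf ℛ.inputOf.pedV ℛ.inputOf.liveCV cellOf phys) K,
        supSum (kmemOf ℛ.inputOf.pedV ℛ.inputOf.liveCV cellOf phys) K k (cwOf Φf t) ≤ W K)
    (hCN : ∀ K, K₀ ≤ K →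
      ∀ k ∈ badGMems (memOf ℛ.inputOf.pedV ℛ.inputOf.liveCV cellOf) jstar (HIndex.termSet I)
          (kmemOf ℛ.inputOf.pedV ℛ.inputOf.liveCV cellOf phys) K,
        ∀ w ∈ k, ∀ e ∈ w.2.1.events, (C K w e).card ≤ N K e)
    (hN : ∀ K e, ((N K e : ℕ) : ℝ) ≤ Real.exp (sharpT (φB K) (φR K) e)) :
    ∀ K t, |t| ≤ l₀ → K₀ ≤ K →
      ∀ k ∈ badGMems (memOf ℛ.inputOf.pedV ℛ.inputOf.liveCV cellOf) jstar (HIndex.termSet I)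
          (kmemOf ℛ.inputOf.pedV ℛ.inputOf.liveCV cellOf phys) K,
        ∑ τ ∈ fibre (kmemOf ℛ.inputOf.pedV ℛ.inputOf.liveCV cellOf phys) (HIndex.termSet I) K k,
          dmassOf ℛ Φf t τ ≤ W K * MULTOf (sharpT (φB K) (φR K)) k := by
  intro K t ht hK k hk
  have hdead := (ℛ.died_empty_iff_noHealing hIN hIRm hID hL).2 hNH
  refine fibreMass_of_supSum_count_MULTOf _ K k (dmassOf ℛ Φf t) (cwOf Φf t) (sharpT (φB K) (φR K)) (C K)
    (hsup K t ht hK k hk) (hcount K hK k hk) (fun τ hτ => ?_) fun w hw e he => ?_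
  · -- (ρ0): the dead part is `1`, so the mass is the curly weight
    obtain ⟨hτT, -⟩ := mem_fibre.1 hτ
    obtain ⟨a, h, l, c, -, rfl⟩ := eq_of_mem_termSet hτT
    rw [dmassOf_eq_of_died_empty ℛ Φf t a h l c (fun j hj => hdead K hK _ hτT j hj), cwOf_mk]
  · -- (ρ3): the choice words are counted by the letters, within the booked shares
    exact (Nat.cast_le.2 (hCN K hK k hk w hw e he)).trans (hN K e)

end Junction



/-! ## §4 The record-facing instance: `HistReadDataL(W).hρ` VERBATIM at the (α) carriers `cellA`∕`physA`∕`jhalf` -/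

section Record

omit [Inhabited β]

variable {F : T4Family} {n : ℕ} {hn : 0 < n} (ℛ : HistReading I d) (Φf : HistFactors I d) (l₀ : ℝ) (K₀ : ℕ)
  (W : ℕ → ℝ) (φB : ℕ → ℕ → ℕ → ℝ) (φR : ℕ → ℕ → ℝ)
  (C : ℕ → (Fin d → ℕ) × Gen PEv × Multiset (PEv × ((Fin d → ℕ) × Finset (Pt d))) → PEv → Finset β) (N : ℕ → PEv → ℕ)

/-- **THE FIELD `hρ` OF THE (α) RECORDS FROM THE THREE SENTENCES** at the record's carriers (`memA n F.L ℛ`,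
`kmemA n F.L hn _ ℛ`, cut `jhalf`): §3 at the (α) carriers (equivalently `hρ_of_indexDecor ∘ indexDecor_of_sentences`,
which needs `[Inhabited β]`; this route does not). The hypotheses are, letter for letter,
`HistReadDataLWK`'s `hN`∕`hRm`∕`hD`, `0 < ℛ.L`, the NO-HEALING sentence (⟺ `kdDied`, g55), the COUNT (⟺ ∃ `kdDec`,
`kdMem` ∧ `kdInj`, g56), the SUPSUM (⟺ ∃ `kdV`, `kdV0` ∧ `kdEnv` ∧ `kdW`, g57), and `kdCN`∕`kdShare`. [folklore] -/
theorem hρ_of_sentences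
    (hIN : ∀ K, K₀ ≤ K → ∀ τ ∈ HIndex.termSet I K, (ℛ.inputOf.run K τ).NewOK)
    (hIRm : ∀ K, K₀ ≤ K → ∀ τ ∈ HIndex.termSet I K, ∀ t k, (ℛ.inputOf.run K τ).Rm t k ≤ (ℛ.inputOf.run K τ).R t)
    (hID : ∀ K, K₀ ≤ K → ∀ τ ∈ HIndex.termSet I K, (ℛ.inputOf.run K τ).NewDisjoint) (hL : 0 < ℛ.L)
    (hNH : ∀ K, K₀ ≤ K → ∀ τ ∈ HIndex.termSet I K, (ℛ.inputOf.run K τ).NoHealing K)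
    (hcount : ∀ K, K₀ ≤ K →
      ∀ k ∈ badGMems (memA n F.L ℛ) jhalf (HIndex.termSet I)
          (kmemA n F.L hn (lt_of_lt_of_le (by norm_num) (two_le_L F)) ℛ) K,
        ∀ (a : (I K).Adm) (c : (I K).HC),
          (pairsOf (kmemA n F.L hn (lt_of_lt_of_le (by norm_num) (two_le_L F)) ℛ) K k a c).card ≤
            ∏ w ∈ k, (decG (C K w) w.2.1).card)
    (hsup : ∀ K t, |t| ≤ l₀ → K₀ ≤ K →
      ∀ k ∈ badGMems (memA n F.L ℛ) jhalf (HIndex.termSet I)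
          (kmemA n F.L hn (lt_of_lt_of_le (by norm_num) (two_le_L F)) ℛ) K,
        supSum (kmemA n F.L hn (lt_of_lt_of_le (by norm_num) (two_le_L F)) ℛ) K k (cwOf Φf t) ≤ W K)
    (hCN : ∀ K, K₀ ≤ K →
      ∀ k ∈ badGMems (memA n F.L ℛ) jhalf (HIndex.termSet I)
          (kmemA n F.L hn (lt_of_lt_of_le (by norm_num) (two_le_L F)) ℛ) K,
        ∀ w ∈ k, ∀ e ∈ w.2.1.events, (C K w e).card ≤ N K e)
    (hN : ∀ K e, ((N K e : ℕ) : ℝ) ≤ Real.exp (sharpT (φB K) (φR K) e)) :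
    ∀ K t, |t| ≤ l₀ → K₀ ≤ K →
      ∀ k ∈ badGMems (memA n F.L ℛ) jhalf (HIndex.termSet I)
          (kmemA n F.L hn (lt_of_lt_of_le (by norm_num) (two_le_L F)) ℛ) K,
        ∑ τ ∈ fibre (kmemA n F.L hn (lt_of_lt_of_le (by norm_num) (two_le_L F)) ℛ) (HIndex.termSet I) K k,
          dmassOf ℛ Φf t τ ≤ W K * MULTOf (sharpT (φB K) (φR K)) k :=
  fibreMass_of_sentences ℛ Φf l₀ K₀ W φB φR (cellA n F.L ℛ)
    (physA n F.L hn (lt_of_lt_of_le (by norm_num) (two_le_L F)) ℛ) jhalf C N hIN hIRm hID hL hNH hcount hsup hCN hN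

end Record

end

end Summit.QuantumFields.BalabanUV.T4Continuum.HistoryBankingFibreSentences
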